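import Summits.QuantumFields.YangMills.Theorems.UnitScaleTiltProp7CombVsAxialMeans
import Summits.QuantumFields.YangMills.Theorems.UnitScaleTiltProp7TentFrameRowsOfRegPr
import HarnessLib

/-!
# Route `UnitScaleTilt`, crux K1 (stmt-QuantumFields-19200), stub `stub_existenceMinimalOrbit` (EX), LANE II (★★OWNER RULING №23), (B7) `hRows` [I-5] — **THE CONVERSION ROW AT THE MEMBER**:
# ✓`Prop7CombVsAxialMeans` read at `V := W♯ = pull (bgUnits F K W) (basePt F n K)`, `ℓ = L^{K−n}`, on print's regular space `RegPr F n K e W`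

Cell `ym3-torus`, width seat `ym3-torus-px5` (gen 7).  THEOREMS ONLY (0 `def`, 0 `sorry`); `--supports stmt-QuantumFields-19200 --as helper`, count-neutral.  YM₃ on T³ is a ladder
rung (R3), not the Clay problem; nothing here claims the stub, the crux, d = 4 or the mass gap.

WHAT IS PROVED (ns `…Theorems.Prop7CombVsAxialMeansMember`).  On `RegPr F n K e W` with `0 < e ≤ e₄ L := min (6·C₀(3))⁻¹ (c₂′(3,L)∕4)` (px15's radius ✓`tentFrame_rep_of_regPr`):
`pdev W♯ < 2e·ℓ⁻²` (✓`pdev_pull_lt` ∘ ✓`inAk_pull_of_regPr`), the Prop. 2 tower hypotheses hold at `α₀ := 2e` over the `SU(2)`-closed subgroup (lit ✓`avgClosed_specialUnitary_of_le_twentyone`),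
so ✓`norm_QprimeIter_sub_conj_axialMean_le` reads, for a patch whose fine extent is `≤ M·ℓ` above the gauge root `lo` (`M` = number of blocks, e.g. `4R+6` for the box of NAMER WORD №14):
* §1 ★★★ `comb_vs_axialMean_of_regPr` — `‖(Q′_k φ)(b) − Ad(u x_b)⁻¹(axial block mean)‖ ≤ (29232 + 36M)·e·(block mean of ‖φ‖)` (`2·(7308·2e) + 2·3(ℓ−1)·3Mℓ·2eℓ⁻² ≤ (29232+36M)e`);
* §2 ★★★ `combDiff_vs_axialDiff_of_regPr` — the bond row with the route's coarse transporter `T` under the (B3c) rider (`‖T c − W♯(corner; ℓ steps)‖ ≤ CT·e`, ✓`descent_straight_closeness`,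
  read on ℤ³ by ✓`norm_pull_sub_hol_seg_le`): error `≤ (2CT + 12M)e·(mean′‖φ‖) + (29232 + 36M)e·(mean′‖φ‖ + mean‖φ‖)`.
* §3 ★★★ `sum_sq_mass_conv_of_regPr` ∕ ★★★ `sum_sq_grad_conv_of_regPr` — the squared∕summed currencies over any finite set of blocks ∕ coarse bonds of the patch, BOTH directions
  (✓`sum_sq_covMean_le_and_ge` ∕ ✓`sum_sq_covDiff_le_and_ge` at `γ′ = (2CT + 48M + 29232)ε`, `γ = (29232 + 36M)ε`) — NAMER WORD №13's «cost `R⁴e²Φ`» after (B9d)'s `R²`.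

HONEST SCOPE.  Arithmetic over landed theorems; the `tlift`∕patch bookkeeping of (a′) and the knit into `hRows` ([I-9]) are the consumers'.  Nothing of (B9d), (REC), `hN06`, the stub or the crux.

References: T. Bałaban, CMP 99 (1985) 389–434 [Balaban1985BackgroundPropagators] ((3.19) p.393); CMP 102 (1985) 277–309 [Balaban1985Variational] ((2), (6) p.278, (146) p.301);
CMP 98 (1985) 17–51 [Balaban1985Averaging] ((42)–(43) pp.23–24, (52)–(54) p.26, (78)–(80) p.30); CMP 99 (1985) 75–102 [Balaban1985RegularSpaces] ((1.7) p.77, (1.70) p.88).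
-/

set_option autoImplicit false
noncomputable section
open scoped BigOperators Matrix.Norms.L2Operator

namespace Summit.QuantumFields.YangMills.Theorems.Prop7CombVsAxialMeansMember

open Literature.MathematicalPhysics.QuantumFieldTheory.Balaban1983to89
open Literature.MathematicalPhysics.QuantumFieldTheory.Balaban1983to89.T3ContinuumYM3Torus
open Literature.MathematicalPhysics.QuantumFieldTheory.Balaban1983to89.T3PrintedRegularMinimiser (RegPr)
open Literature.MathematicalPhysics.QuantumLattice (blockMap blockBase blockSites)
open B7Prop1Explicit renaming Site → LSite
open B7Prop1Explicit (U1 mem_U1 axialFn e seg hol axialFn_mem)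
open B7Prop2Explicit (pdev le_pdev pdev_nonneg C0 c2' C0_pos c2'_pos unitaryUnits_le_U1)
open B7AvgClosedSpecialUnitarySharp (avgClosed_specialUnitary_of_le_twentyone)
open B7Eq78Linearization (conjR QprimeIter zdBlocking)
open B8Eq119TwistedAxial (bgT)
open B9B8AveragingKernelZd (blockIter compT QprimeIter_zd_eq_sum_blockIter)
open B10Eq27TorusAxialLog (transl pull pull_apply holT unitsField toUField)
open T4TermwiseTorus (tlift)
open T3SectALandauChart (bgUnits)
open Summit.QuantumFields.YangMills.Theorems.Prop7SPrint (basePt)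
open Summit.QuantumFields.YangMills.Theorems.Prop7QprimeCombBumpSectionRows (pull_bgUnits_mem_U1)
open Summit.QuantumFields.YangMills.Theorems.Prop7AxialReprPrint (inAk_pull_of_regPr pdev_pull_lt pull_toUField_mem)
open Summit.QuantumFields.YangMills.Theorems.Prop7TentFrameRowsOfRegPr (norm_pull_sub_hol_seg_le pull_mem_U1_of)
open Summit.QuantumFields.YangMills.Theorems.Prop7CombVsAxialMeans (norm_QprimeIter_sub_conj_axialMean_le norm_covDiff_sub_conj_axialDiff_le compT_bgT_mem_U1
  sum_sq_covMean_le_and_ge sum_sq_covDiff_le_and_ge)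
open Summit.QuantumFields.YangMills.Theorems.Prop7CombVsAxialTransport (norm_compT_bgT_sub_axialFn_le)
open Summit.QuantumFields.YangMills.Theorems.Prop7TentProfileZd (blockIter_eq_blockSites_pow)

variable (F : T3Family) (n K : ℕ)

/-- the member arithmetic: on `RegPr` within px15's radius, the Prop. 2 tower hypotheses at `α₀ := 2e` and the re-rooting cost `3(ℓ−1)·(3·Mℓ)·pdev W♯ ≤ 18·M·e`.
[cite: Balaban1985Variational, (2), (6) p.278; Balaban1985Averaging, (52)–(54) p.26] -/
theorem tower_hyps_of_regPr {L : ℕ} (hL : 1 < L) (hF : F.L = L) {ε : ℝ} (he : 0 < ε) (he4 : ε ≤ min (6 * C0 3)⁻¹ (c2' 3 L / 4))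
    {W : GaugeField (F.P K) 0 (Matrix.specialUnitaryGroup (Fin 2) ℂ)} (hW : RegPr F n K ε W) (M : ℕ) :
    C0 (F.P K).d * (2 * ε) ≤ 1 / 3 ∧ 2 * (2 * ε) ≤ c2' (F.P K).d (F.P K).L ∧
    pdev (pull (bgUnits F K W) (basePt F n K)) < 2 * ε * ((((F.P K).L : ℝ) ^ (K - n))⁻¹) ^ 2 ∧
    ((F.P K).d * ((F.P K).L ^ (K - n) - 1 : ℕ) : ℝ) * (((F.P K).d * (M * (F.P K).L ^ (K - n) : ℕ)) * pdev (pull (bgUnits F K W) (basePt F n K))) ≤ 18 * M * ε := by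
  have hd : (F.P K).d = 3 := T3Family.P_d F K
  have hFL : (F.P K).L = L := hF
  have hC0 : 0 < C0 3 := C0_pos 3
  have he1 : ε ≤ (6 * C0 3)⁻¹ := he4.trans (min_le_left _ _)
  have he2 : ε ≤ c2' 3 L / 4 := he4.trans (min_le_right _ _)
  have hα3 : C0 (F.P K).d * (2 * ε) ≤ 1 / 3 := by
    rw [hd]
    have : C0 3 * ε ≤ C0 3 * (6 * C0 3)⁻¹ := mul_le_mul_of_nonneg_left he1 hC0.le
    have h6 : C0 3 * (6 * C0 3)⁻¹ = 1 / 6 := by field_simp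
    linarith
  have hα2 : 2 * (2 * ε) ≤ c2' (F.P K).d (F.P K).L := by rw [hd, hFL]; linarith
  have h52 : pdev (pull (bgUnits F K W) (basePt F n K)) < 2 * ε * ((((F.P K).L : ℝ) ^ (K - n))⁻¹) ^ 2 :=
    pdev_pull_lt he (inAk_pull_of_regPr F he.le hW) (basePt F n K)
  refine ⟨hα3, hα2, h52, ?_⟩
  -- the re-rooting cost: `3(ℓ−1)·3Mℓ·pdev ≤ 3ℓ·3Mℓ·2eℓ⁻² = 18Me`
  set ℓr : ℝ := ((F.P K).L : ℝ) ^ (K - n) with hℓr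
  have hL0 : (0 : ℝ) < (F.P K).L := by rw [hFL]; exact_mod_cast (lt_trans Nat.zero_lt_one hL)
  have hℓ0 : 0 < ℓr := by rw [hℓr]; positivity
  have hpd0 : 0 ≤ pdev (pull (bgUnits F K W) (basePt F n K)) := pdev_nonneg _
  have h1 : (((F.P K).L ^ (K - n) - 1 : ℕ) : ℝ) ≤ ℓr := by
    rw [hℓr, ← Nat.cast_pow]; exact_mod_cast Nat.sub_le _ _
  have h2 : ((M * (F.P K).L ^ (K - n) : ℕ) : ℝ) = M * ℓr := by rw [hℓr]; push_cast; ring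
  have hd' : ((F.P K).d : ℝ) = 3 := by exact_mod_cast hd
  rw [hd', h2]
  calc (3 : ℝ) * (((F.P K).L ^ (K - n) - 1 : ℕ) : ℝ) * (3 * (M * ℓr) * pdev (pull (bgUnits F K W) (basePt F n K)))
      ≤ 3 * ℓr * (3 * (M * ℓr) * (2 * ε * (ℓr⁻¹) ^ 2)) :=
        mul_le_mul (mul_le_mul_of_nonneg_left h1 (by norm_num)) (mul_le_mul_of_nonneg_left h52.le (by positivity))
          (by positivity) (by positivity)
    _ = 18 * M * ε := by field_simp; ring

/-- ★★★ **[I-5-conv] AT THE MEMBER — THE COMB MEAN AGAINST THE CONJUGATED AXIAL BLOCK MEAN**: for every `L > 1` there is `e₄ > 0` (`min (6C₀(3))⁻¹ (c₂′(3,L)∕4)`) such that on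
`RegPr F n K ε W`, `0 < ε ≤ e₄`, with `V := W♯`, `ℓ := L^{K−n}`, for every gauge root `lo ≤ ℓ·b` with the block `B^k(b)` at fine height `≤ M·ℓ` above `lo` and every `φ`:
`‖(Q′_k φ)(b) − Ad(axialFn V lo (ℓb))⁻¹(Σ_{B^k(b)} (L⁻³)ᵏ•Ad(axialFn V lo x)(φ x))‖ ≤ (29232 + 36M)·e·Σ_{B^k(b)} (L⁻³)ᵏ‖φ x‖` — the letter of ✓`QprimeCombL2_apply` on the left.
[cite: Balaban1985BackgroundPropagators, (3.19) p.393; Balaban1985Variational, (2), (6) p.278; Balaban1985Averaging, (42)–(43) pp.23–24, (52)–(54) p.26, (78)–(80) p.30] -/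
theorem comb_vs_axialMean_of_regPr {L : ℕ} (hL : 1 < L) (hF : F.L = L) {ε : ℝ} (he : 0 < ε) (he4 : ε ≤ min (6 * C0 3)⁻¹ (c2' 3 L / 4))
    {W : GaugeField (F.P K) 0 (Matrix.specialUnitaryGroup (Fin 2) ℂ)} (hW : RegPr F n K ε W)
    (lo b : LSite (F.P K).d) (hlo : lo ≤ blockBase ((F.P K).L ^ (K - n)) b) (M : ℕ)
    (hR : ∀ x ∈ blockIter (F.P K).L (K - n) b, ∀ i, x i - lo i ≤ ((M * (F.P K).L ^ (K - n) : ℕ) : ℤ))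
    (φ : LSite (F.P K).d → Matrix (Fin 2) (Fin 2) ℂ) :
    ‖QprimeIter (zdBlocking (F.P K).d (F.P K).L) (bgT (F.P K).L (pull (bgUnits F K W) (basePt F n K))) (K - n) φ b
        - conjR (axialFn (pull (bgUnits F K W) (basePt F n K)) lo (blockBase ((F.P K).L ^ (K - n)) b))⁻¹
            (∑ x ∈ blockIter (F.P K).L (K - n) b, (((((F.P K).L : ℝ) ^ (F.P K).d)⁻¹) ^ (K - n)) • conjR (axialFn (pull (bgUnits F K W) (basePt F n K)) lo x) (φ x))‖
      ≤ (29232 + 36 * M) * ε * ∑ x ∈ blockIter (F.P K).L (K - n) b, ((((F.P K).L : ℝ) ^ (F.P K).d)⁻¹) ^ (K - n) * ‖φ x‖ := by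
  have hd : (F.P K).d = 3 := T3Family.P_d F K
  have hL2 : 2 ≤ (F.P K).L := by rw [show (F.P K).L = L from hF]; omega
  obtain ⟨hα3, hα2, h52, hκ⟩ := tower_hyps_of_regPr F n K hL hF he he4 hW M
  have hα : 0 < 2 * ε := by positivity
  set V := pull (bgUnits F K W) (basePt F n K) with hV
  have hG := avgClosed_specialUnitary_of_le_twentyone (N := 2) (by norm_num) (F.P K).d (F.P K).L
  have hVmem : ∀ x κ, V x κ ∈ B7Prop2SpecialUnitary.specialUnitaryUnits (Fin 2) := pull_toUField_mem W (basePt F n K)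
  have hmain := norm_QprimeIter_sub_conj_axialMean_le (F.P K).L hL2 hG V hVmem (K - n) hα hα3 hα2 h52 lo b hlo hR φ
  refine hmain.trans (mul_le_mul_of_nonneg_right ?_ (Finset.sum_nonneg fun x _ => by positivity))
  have h7308 : (87 : ℝ) * (F.P K).d * ((F.P K).d + 1) * ((F.P K).d + 4) * (2 * ε) = 14616 * ε := by rw [hd]; push_cast; ring
  rw [h7308]
  nlinarith [hκ]

/-- ★★★ **[I-5-conv] AT THE MEMBER — THE `Ū`-DIFFERENCE AGAINST THE FLAT DIFFERENCE OF AXIAL MEANS**: same explicit radius; `T` any unit-bounded coarse transporter with the (B3c) rider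
`‖T c − W♯(corner c; ℓ steps e_c)‖ ≤ CT·e` (the route's `descendToGL …`, ✓`descent_straight_closeness`); coarse bond `(b, μ)` on ℤ³ with both blocks at fine height `≤ Mℓ` above `lo`:
`‖(Ad(T♯(b,μ))(Q′_kφ)(b+e_μ) − (Q′_kφ)(b)) − Ad(axialFn V lo (ℓb))⁻¹(A_{b+e_μ} − A_b)‖ ≤ (2CT + 12M)e·Σ_{B^k(b+e_μ)}(L⁻³)ᵏ‖φ‖ + (29232 + 36M)e·(Σ_{B^k(b+e_μ)} + Σ_{B^k(b)})(L⁻³)ᵏ‖φ‖`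
(`T♯ := pull T 0`, `A_b := Σ_{B^k(b)} (L⁻³)ᵏ•Ad(axialFn V lo x)(φ x)`). [cite: Balaban1985BackgroundPropagators, (3.19) p.393, (3.24)–(3.26) pp.394–395; Balaban1987RG1, (0.4) p.253] -/
theorem combDiff_vs_axialDiff_of_regPr {L : ℕ} (hL : 1 < L) (hF : F.L = L) (hnK : n ≤ K) {ε : ℝ} (he : 0 < ε) (he4 : ε ≤ min (6 * C0 3)⁻¹ (c2' 3 L / 4))
    {W : GaugeField (F.P K) 0 (Matrix.specialUnitaryGroup (Fin 2) ℂ)} (hW : RegPr F n K ε W)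
    {CT : ℝ} (T : PBond (F.P K) (K - n) → (Matrix (Fin 2) (Fin 2) ℂ)ˣ) (hTU1 : ∀ c, T c ∈ U1 (Matrix (Fin 2) (Fin 2) ℂ))
    (hclose : ∀ c : PBond (F.P K) (K - n),
      ‖(T c : Matrix (Fin 2) (Fin 2) ℂ) - ((holT (unitsField (toUField W)) (transl (basePt F n K) (blockBase ((F.P K).L ^ (K - n)) (tlift c.src)))
          (List.replicate ((F.P K).L ^ (K - n)) (c.dir, true)) : (Matrix (Fin 2) (Fin 2) ℂ)ˣ) : Matrix (Fin 2) (Fin 2) ℂ)‖ ≤ CT * ε)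
    (lo b : LSite (F.P K).d) (μ : Fin (F.P K).d) (hlo : lo ≤ blockBase ((F.P K).L ^ (K - n)) b) (M : ℕ)
    (hR : ∀ x ∈ blockIter (F.P K).L (K - n) b, ∀ i, x i - lo i ≤ ((M * (F.P K).L ^ (K - n) : ℕ) : ℤ))
    (hR' : ∀ x ∈ blockIter (F.P K).L (K - n) (b + e μ), ∀ i, x i - lo i ≤ ((M * (F.P K).L ^ (K - n) : ℕ) : ℤ))
    (φ : LSite (F.P K).d → Matrix (Fin 2) (Fin 2) ℂ) :
    ‖(conjR (pull T 0 b μ)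
          (QprimeIter (zdBlocking (F.P K).d (F.P K).L) (bgT (F.P K).L (pull (bgUnits F K W) (basePt F n K))) (K - n) φ (b + e μ))
        - QprimeIter (zdBlocking (F.P K).d (F.P K).L) (bgT (F.P K).L (pull (bgUnits F K W) (basePt F n K))) (K - n) φ b)
      - conjR (axialFn (pull (bgUnits F K W) (basePt F n K)) lo (blockBase ((F.P K).L ^ (K - n)) b))⁻¹
          (∑ x ∈ blockIter (F.P K).L (K - n) (b + e μ), (((((F.P K).L : ℝ) ^ (F.P K).d)⁻¹) ^ (K - n)) • conjR (axialFn (pull (bgUnits F K W) (basePt F n K)) lo x) (φ x)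
            - ∑ x ∈ blockIter (F.P K).L (K - n) b, (((((F.P K).L : ℝ) ^ (F.P K).d)⁻¹) ^ (K - n)) • conjR (axialFn (pull (bgUnits F K W) (basePt F n K)) lo x) (φ x))‖
      ≤ (2 * CT + 12 * M) * ε * ∑ x ∈ blockIter (F.P K).L (K - n) (b + e μ), ((((F.P K).L : ℝ) ^ (F.P K).d)⁻¹) ^ (K - n) * ‖φ x‖
        + (29232 + 36 * M) * ε * (∑ x ∈ blockIter (F.P K).L (K - n) (b + e μ), ((((F.P K).L : ℝ) ^ (F.P K).d)⁻¹) ^ (K - n) * ‖φ x‖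
            + ∑ x ∈ blockIter (F.P K).L (K - n) b, ((((F.P K).L : ℝ) ^ (F.P K).d)⁻¹) ^ (K - n) * ‖φ x‖) := by
  have hd : (F.P K).d = 3 := T3Family.P_d F K
  have hL2 : 2 ≤ (F.P K).L := by rw [show (F.P K).L = L from hF]; omega
  haveI : NeZero (F.P K).L := ⟨by omega⟩
  obtain ⟨hα3, hα2, h52, hκ⟩ := tower_hyps_of_regPr F n K hL hF he he4 hW M
  have hα : 0 < 2 * ε := by positivity
  set V := pull (bgUnits F K W) (basePt F n K) with hV
  have hℓ1 : 1 ≤ (F.P K).L ^ (K - n) := Nat.one_le_pow _ _ (by omega)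
  have hG := avgClosed_specialUnitary_of_le_twentyone (N := 2) (by norm_num) (F.P K).d (F.P K).L
  have hVmem : ∀ x κ, V x κ ∈ B7Prop2SpecialUnitary.specialUnitaryUnits (Fin 2) := pull_toUField_mem W (basePt F n K)
  have hV1 : ∀ x κ, V x κ ∈ U1 (Matrix (Fin 2) (Fin 2) ℂ) := fun x κ => pull_bgUnits_mem_U1 W (basePt F n K) x κ
  have hP : ∀ (x : LSite (F.P K).d) (κ μ : Fin (F.P K).d), κ ≠ μ →
      ‖((hol V x (B7Prop1Explicit.plaqWord κ μ) : (Matrix (Fin 2) (Fin 2) ℂ)ˣ) : Matrix (Fin 2) (Fin 2) ℂ) - 1‖ ≤ pdev V := fun x κ μ _ => le_pdev hV1 x κ μ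
  -- the two blocks' comb transporters (F3) and their unit-ball membership
  have hT : ∀ y : LSite (F.P K).d, ∀ x ∈ blockSites ((F.P K).L ^ (K - n)) y,
      ‖((compT (F.P K).L (bgT (F.P K).L V) (K - n) y x : (Matrix (Fin 2) (Fin 2) ℂ)ˣ) : Matrix (Fin 2) (Fin 2) ℂ)
          - ((axialFn V (blockBase ((F.P K).L ^ (K - n)) y) x : (Matrix (Fin 2) (Fin 2) ℂ)ˣ) : _)‖
        ≤ 87 * (F.P K).d * ((F.P K).d + 1) * ((F.P K).d + 4) * (2 * ε) := fun y x hx =>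
    norm_compT_bgT_sub_axialFn_le (F.P K).L hL2 hG V hVmem (K - n) hα hα3 hα2 h52 y x (by rwa [blockIter_eq_blockSites_pow])
  have hT1 : ∀ y : LSite (F.P K).d, ∀ x ∈ blockSites ((F.P K).L ^ (K - n)) y,
      compT (F.P K).L (bgT (F.P K).L V) (K - n) y x ∈ U1 (Matrix (Fin 2) (Fin 2) ℂ) := fun y x _ =>
    compT_bgT_mem_U1 (F.P K).L hL2 hG V hVmem (K - n) hα hα3 hα2 h52 (K - n) le_rfl y x
  -- the coarse transporter `T♯(b, μ)` and its (B3c) rider read on `ℤ³`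
  have hU1 : pull T 0 b μ ∈ U1 (Matrix (Fin 2) (Fin 2) ℂ) := pull_mem_U1_of F K hTU1 0 b μ
  have hbb : blockBase ((F.P K).L ^ (K - n)) b = ((((F.P K).L ^ (K - n) : ℕ)) : ℤ) • b := by
    funext i; simp only [blockBase, Pi.smul_apply, smul_eq_mul]
  have hE : ‖((pull T 0 b μ : (Matrix (Fin 2) (Fin 2) ℂ)ˣ) : Matrix (Fin 2) (Fin 2) ℂ)
      - ((hol V (blockBase ((F.P K).L ^ (K - n)) b) (seg μ (((F.P K).L ^ (K - n) : ℕ) : ℤ)) : (Matrix (Fin 2) (Fin 2) ℂ)ˣ) : _)‖ ≤ CT * ε := by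
    rw [hbb]; exact norm_pull_sub_hol_seg_le F n K hnK W T hclose b μ
  have hω : (0 : ℝ) ≤ ((((F.P K).L : ℝ) ^ (F.P K).d)⁻¹) ^ (K - n) := by positivity
  rw [blockIter_eq_blockSites_pow] at hR hR'
  have hmain := norm_covDiff_sub_conj_axialDiff_le hV1 (pdev_nonneg V) hP lo hℓ1 b μ hlo hR hR' _ _ (hT1 b) (hT1 (b + e μ)) (hT b) (hT (b + e μ))
    (pull T 0 b μ) hU1 hE φ hω
  rw [QprimeIter_zd_eq_sum_blockIter, QprimeIter_zd_eq_sum_blockIter, blockIter_eq_blockSites_pow, blockIter_eq_blockSites_pow]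
  refine hmain.trans ?_
  have hS0 : ∀ s : Finset (LSite (F.P K).d), 0 ≤ ∑ x ∈ s, ((((F.P K).L : ℝ) ^ (F.P K).d)⁻¹) ^ (K - n) * ‖φ x‖ :=
    fun s => Finset.sum_nonneg fun x _ => by positivity
  have h7308 : (87 : ℝ) * (F.P K).d * ((F.P K).d + 1) * ((F.P K).d + 4) * (2 * ε) = 14616 * ε := by rw [hd]; push_cast; ring
  -- the bond transporter cost `ℓ·(3·Mℓ)·pdev ≤ 6Mε`
  have hκ' : (((F.P K).L ^ (K - n) : ℕ) : ℝ) * (((F.P K).d * (M * (F.P K).L ^ (K - n) : ℕ)) * pdev V) ≤ 6 * M * ε := by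
    have hℓ0 : (0 : ℝ) < ((F.P K).L : ℝ) ^ (K - n) := by
      have : (0 : ℝ) < (F.P K).L := by exact_mod_cast (show 0 < (F.P K).L by omega)
      positivity
    have h2 : ((M * (F.P K).L ^ (K - n) : ℕ) : ℝ) = M * ((F.P K).L : ℝ) ^ (K - n) := by push_cast; ring
    have hd' : ((F.P K).d : ℝ) = 3 := by exact_mod_cast hd
    rw [hd', h2, Nat.cast_pow]
    calc ((F.P K).L : ℝ) ^ (K - n) * (3 * (M * ((F.P K).L : ℝ) ^ (K - n)) * pdev V)
        ≤ ((F.P K).L : ℝ) ^ (K - n) * (3 * (M * ((F.P K).L : ℝ) ^ (K - n)) * (2 * ε * ((((F.P K).L : ℝ) ^ (K - n))⁻¹) ^ 2)) :=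
          mul_le_mul_of_nonneg_left (mul_le_mul_of_nonneg_left h52.le (by positivity)) (by positivity)
      _ = 6 * M * ε := by field_simp; ring
  rw [h7308] at hmain ⊢
  nlinarith [hκ, hκ', hS0 (blockSites ((F.P K).L ^ (K - n)) (b + e μ)), hS0 (blockSites ((F.P K).L ^ (K - n)) b), he]

/-! ## §3 Summed over a patch: NAMER WORD №13's currencies (both directions) -/

/-- the uniform block weight is normalised: `(L⁻ᵈ)ᵏ · #(blockIter L k b) = 1`. [cite: Balaban1985Averaging, (78) p.30] -/
theorem weight_mul_card_blockIter {L : ℕ} (hL : 1 ≤ L) (d k : ℕ) (b : LSite d) :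
    haveI : NeZero L := ⟨by omega⟩
    ((((L : ℝ) ^ d)⁻¹) ^ k) * ((blockIter L k b).card : ℝ) = 1 := by
  haveI : NeZero L := ⟨by omega⟩
  have hL0 : (0 : ℝ) < L := by exact_mod_cast (show 0 < L by omega)
  rw [blockIter_eq_blockSites_pow, Literature.MathematicalPhysics.QuantumLattice.card_blockSites]
  push_cast
  rw [← inv_pow, ← pow_mul, ← pow_mul, mul_comm k d, ← mul_pow, inv_mul_cancel₀ hL0.ne', one_pow]

/-- ★★★ **THE MASS CURRENCY, BOTH DIRECTIONS, AT THE MEMBER**: over any finite set `P` of blocks of the patch (each at fine height `≤ Mℓ` above the gauge root `lo`), with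
`Q b := (Q′_k φ)(b)`, `A b := Σ_{B^k(b)} (L⁻³)ᵏ•Ad(axialFn W♯ lo x)(φ x)` and `γ := (29232 + 36M)ε`:
`Σ_P ‖Q b‖² ≤ 2Σ_P ‖A b‖² + 2γ²·(L⁻³)ᵏ·Σ_PΣ_{B^k(b)}‖φ‖²` and `Σ_P ‖A b‖² ≤ 2Σ_P ‖Q b‖² + 2γ²·(L⁻³)ᵏ·Σ_PΣ_{B^k(b)}‖φ‖²` (§1 ∘ ✓`sum_sq_covMean_le_and_ge`).
[cite: Balaban1985BackgroundPropagators, (3.19) p.393, (3.24)–(3.26) pp.394–395] -/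
theorem sum_sq_mass_conv_of_regPr {L : ℕ} (hL : 1 < L) (hF : F.L = L) {ε : ℝ} (he : 0 < ε) (he4 : ε ≤ min (6 * C0 3)⁻¹ (c2' 3 L / 4))
    {W : GaugeField (F.P K) 0 (Matrix.specialUnitaryGroup (Fin 2) ℂ)} (hW : RegPr F n K ε W)
    (lo : LSite (F.P K).d) (M : ℕ) (P : Finset (LSite (F.P K).d))
    (hP : ∀ b ∈ P, lo ≤ blockBase ((F.P K).L ^ (K - n)) b ∧ ∀ x ∈ blockIter (F.P K).L (K - n) b, ∀ i, x i - lo i ≤ ((M * (F.P K).L ^ (K - n) : ℕ) : ℤ))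
    (φ : LSite (F.P K).d → Matrix (Fin 2) (Fin 2) ℂ) :
    (∑ b ∈ P, ‖QprimeIter (zdBlocking (F.P K).d (F.P K).L) (bgT (F.P K).L (pull (bgUnits F K W) (basePt F n K))) (K - n) φ b‖ ^ 2
      ≤ 2 * ∑ b ∈ P, ‖∑ x ∈ blockIter (F.P K).L (K - n) b, (((((F.P K).L : ℝ) ^ (F.P K).d)⁻¹) ^ (K - n)) • conjR (axialFn (pull (bgUnits F K W) (basePt F n K)) lo x) (φ x)‖ ^ 2
        + 2 * ((29232 + 36 * M) * ε) ^ 2 * (((((F.P K).L : ℝ) ^ (F.P K).d)⁻¹) ^ (K - n) * ∑ b ∈ P, ∑ x ∈ blockIter (F.P K).L (K - n) b, ‖φ x‖ ^ 2)) ∧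
    (∑ b ∈ P, ‖∑ x ∈ blockIter (F.P K).L (K - n) b, (((((F.P K).L : ℝ) ^ (F.P K).d)⁻¹) ^ (K - n)) • conjR (axialFn (pull (bgUnits F K W) (basePt F n K)) lo x) (φ x)‖ ^ 2
      ≤ 2 * ∑ b ∈ P, ‖QprimeIter (zdBlocking (F.P K).d (F.P K).L) (bgT (F.P K).L (pull (bgUnits F K W) (basePt F n K))) (K - n) φ b‖ ^ 2
        + 2 * ((29232 + 36 * M) * ε) ^ 2 * (((((F.P K).L : ℝ) ^ (F.P K).d)⁻¹) ^ (K - n) * ∑ b ∈ P, ∑ x ∈ blockIter (F.P K).L (K - n) b, ‖φ x‖ ^ 2)) := by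
  have hL1 : 1 ≤ (F.P K).L := by rw [show (F.P K).L = L from hF]; omega
  have hV1 : ∀ x κ, pull (bgUnits F K W) (basePt F n K) x κ ∈ U1 (Matrix (Fin 2) (Fin 2) ℂ) := fun x κ => pull_bgUnits_mem_U1 W (basePt F n K) x κ
  refine sum_sq_covMean_le_and_ge P (fun b => blockIter (F.P K).L (K - n) b) (fun b _ => weight_mul_card_blockIter hL1 _ _ b) _ _
    (fun b => (axialFn (pull (bgUnits F K W) (basePt F n K)) lo (blockBase ((F.P K).L ^ (K - n)) b))⁻¹)
    (fun b _ => (U1 _).inv_mem (axialFn_mem hV1 _ _)) φ fun b hb => ?_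
  exact comb_vs_axialMean_of_regPr F n K hL hF he he4 hW lo b (hP b hb).1 M (hP b hb).2 φ

/-- ★★★ **THE GRADIENT CURRENCY, BOTH DIRECTIONS, AT THE MEMBER** (NAMER WORD №13 [I-5] ∕ ★p1 09:26Z «`Σ‖mean^u(b+e_μ) − mean^u(b)‖² ≤ 2·Gc^{Ū} + Cconv·R²e²Φ`»): over any
finite set `C` of coarse bonds `(b, μ)` of the patch (both blocks at fine height `≤ Mℓ` above `lo`), with `X q := Ad(T♯ q)(Q′_kφ)(b+e_μ) − (Q′_kφ)(b)`, `Y q := A(b+e_μ) − A b`,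
`γ′ := (2CT + 48M + 29232)ε`, `γ := (29232 + 36M)ε`:
`Σ_C‖X‖² ≤ 2Σ_C‖Y‖² + 4(L⁻³)ᵏ(γ′²Σ_CΣ_{B^k(b+e_μ)}‖φ‖² + γ²Σ_CΣ_{B^k(b)}‖φ‖²)` and the same with `X`, `Y` exchanged (§2 ∘ ✓`sum_sq_covDiff_le_and_ge`).
[cite: Balaban1985BackgroundPropagators, (3.19) p.393, (3.24)–(3.26) pp.394–395; Balaban1987RG1, (0.4) p.253] -/
theorem sum_sq_grad_conv_of_regPr {L : ℕ} (hL : 1 < L) (hF : F.L = L) (hnK : n ≤ K) {ε : ℝ} (he : 0 < ε) (he4 : ε ≤ min (6 * C0 3)⁻¹ (c2' 3 L / 4))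
    {W : GaugeField (F.P K) 0 (Matrix.specialUnitaryGroup (Fin 2) ℂ)} (hW : RegPr F n K ε W)
    {CT : ℝ} (T : PBond (F.P K) (K - n) → (Matrix (Fin 2) (Fin 2) ℂ)ˣ) (hTU1 : ∀ c, T c ∈ U1 (Matrix (Fin 2) (Fin 2) ℂ))
    (hclose : ∀ c : PBond (F.P K) (K - n),
      ‖(T c : Matrix (Fin 2) (Fin 2) ℂ) - ((holT (unitsField (toUField W)) (transl (basePt F n K) (blockBase ((F.P K).L ^ (K - n)) (tlift c.src)))
          (List.replicate ((F.P K).L ^ (K - n)) (c.dir, true)) : (Matrix (Fin 2) (Fin 2) ℂ)ˣ) : Matrix (Fin 2) (Fin 2) ℂ)‖ ≤ CT * ε)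
    (lo : LSite (F.P K).d) (M : ℕ) (C : Finset (LSite (F.P K).d × Fin (F.P K).d))
    (hC : ∀ q ∈ C, lo ≤ blockBase ((F.P K).L ^ (K - n)) q.1 ∧
      (∀ x ∈ blockIter (F.P K).L (K - n) q.1, ∀ i, x i - lo i ≤ ((M * (F.P K).L ^ (K - n) : ℕ) : ℤ)) ∧
      (∀ x ∈ blockIter (F.P K).L (K - n) (q.1 + e q.2), ∀ i, x i - lo i ≤ ((M * (F.P K).L ^ (K - n) : ℕ) : ℤ)))
    (φ : LSite (F.P K).d → Matrix (Fin 2) (Fin 2) ℂ) :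
    (∑ q ∈ C, ‖conjR (pull T 0 q.1 q.2)
          (QprimeIter (zdBlocking (F.P K).d (F.P K).L) (bgT (F.P K).L (pull (bgUnits F K W) (basePt F n K))) (K - n) φ (q.1 + e q.2))
        - QprimeIter (zdBlocking (F.P K).d (F.P K).L) (bgT (F.P K).L (pull (bgUnits F K W) (basePt F n K))) (K - n) φ q.1‖ ^ 2
      ≤ 2 * ∑ q ∈ C, ‖∑ x ∈ blockIter (F.P K).L (K - n) (q.1 + e q.2), (((((F.P K).L : ℝ) ^ (F.P K).d)⁻¹) ^ (K - n)) • conjR (axialFn (pull (bgUnits F K W) (basePt F n K)) lo x) (φ x)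
            - ∑ x ∈ blockIter (F.P K).L (K - n) q.1, (((((F.P K).L : ℝ) ^ (F.P K).d)⁻¹) ^ (K - n)) • conjR (axialFn (pull (bgUnits F K W) (basePt F n K)) lo x) (φ x)‖ ^ 2
        + 4 * ((((F.P K).L : ℝ) ^ (F.P K).d)⁻¹) ^ (K - n) *
          (((2 * CT + 48 * M + 29232) * ε) ^ 2 * ∑ q ∈ C, ∑ x ∈ blockIter (F.P K).L (K - n) (q.1 + e q.2), ‖φ x‖ ^ 2
            + ((29232 + 36 * M) * ε) ^ 2 * ∑ q ∈ C, ∑ x ∈ blockIter (F.P K).L (K - n) q.1, ‖φ x‖ ^ 2)) ∧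
    (∑ q ∈ C, ‖∑ x ∈ blockIter (F.P K).L (K - n) (q.1 + e q.2), (((((F.P K).L : ℝ) ^ (F.P K).d)⁻¹) ^ (K - n)) • conjR (axialFn (pull (bgUnits F K W) (basePt F n K)) lo x) (φ x)
            - ∑ x ∈ blockIter (F.P K).L (K - n) q.1, (((((F.P K).L : ℝ) ^ (F.P K).d)⁻¹) ^ (K - n)) • conjR (axialFn (pull (bgUnits F K W) (basePt F n K)) lo x) (φ x)‖ ^ 2
      ≤ 2 * ∑ q ∈ C, ‖conjR (pull T 0 q.1 q.2)
          (QprimeIter (zdBlocking (F.P K).d (F.P K).L) (bgT (F.P K).L (pull (bgUnits F K W) (basePt F n K))) (K - n) φ (q.1 + e q.2))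
        - QprimeIter (zdBlocking (F.P K).d (F.P K).L) (bgT (F.P K).L (pull (bgUnits F K W) (basePt F n K))) (K - n) φ q.1‖ ^ 2
        + 4 * ((((F.P K).L : ℝ) ^ (F.P K).d)⁻¹) ^ (K - n) *
          (((2 * CT + 48 * M + 29232) * ε) ^ 2 * ∑ q ∈ C, ∑ x ∈ blockIter (F.P K).L (K - n) (q.1 + e q.2), ‖φ x‖ ^ 2
            + ((29232 + 36 * M) * ε) ^ 2 * ∑ q ∈ C, ∑ x ∈ blockIter (F.P K).L (K - n) q.1, ‖φ x‖ ^ 2)) := by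
  have hL1 : 1 ≤ (F.P K).L := by rw [show (F.P K).L = L from hF]; omega
  have hV1 : ∀ x κ, pull (bgUnits F K W) (basePt F n K) x κ ∈ U1 (Matrix (Fin 2) (Fin 2) ℂ) := fun x κ => pull_bgUnits_mem_U1 W (basePt F n K) x κ
  refine sum_sq_covDiff_le_and_ge C (fun b => blockIter (F.P K).L (K - n) b) (fun q _ => weight_mul_card_blockIter hL1 _ _ q.1)
    (fun q _ => weight_mul_card_blockIter hL1 _ _ (q.1 + e q.2)) _ _
    (fun b => (axialFn (pull (bgUnits F K W) (basePt F n K)) lo (blockBase ((F.P K).L ^ (K - n)) b))⁻¹)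
    (fun q _ => (U1 _).inv_mem (axialFn_mem hV1 _ _)) φ fun q hq => ?_
  obtain ⟨hlo, hR, hR'⟩ := hC q hq
  have h := combDiff_vs_axialDiff_of_regPr F n K hL hF hnK he he4 hW T hTU1 hclose lo q.1 q.2 hlo M hR hR' φ
  refine h.trans (le_of_eq ?_)
  ring

end Summit.QuantumFields.YangMills.Theorems.Prop7CombVsAxialMeansMember

end
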